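import Summits.AnomalousDissipation.AnomalousDissipation.Theorems.SawtoothPulseCascadeK3NonlinearClosureApproxOfSlaving
import Summits.AnomalousDissipation.AnomalousDissipation.Theorems.SawtoothPulseCascadeK3NonlinearClosureClosureWindow48
import Summits.AnomalousDissipation.AnomalousDissipation.Theorems.SawtoothPulseCascadeK3LocalisedClosureDriftFreeClosure
import HarnessLib

/-!
# K3′ `K3NonlinearClosure` (aside, stmt-AnomalousDissipation-20027), line `Localised` — STUB S5 `stub_localisedClosure`

Registered stub S5 of the line `Localised` (reshape r4, per parameter point of the box, tree vocabulary): inside the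
closure window `max(ρN, 3e^{σ⋆γ})·(γ²+2) < r²`, the localised scalar crux `K1Localised P r`, the existence package
`DriftFree.Existence P` and PLANAR SLAVING of `V_ν` to `ū` up to the horizon `J_r(ν)+A` (body of the line's
`PlanarSlaving P r`) give the planar anomalous family `DriftFree.PlanarAnomalousFamily P`.

Proof = the LANDED drift-free closure `Theorems.SawtoothPulseCascade.DriftFreeClosure.planarAnomalousFamily_of`
(p444010 lineage; Johansson–Sorella Lemma 2.2 bookkeeping: K1loc fraction survives an `∫₀ᵀ‖V−ū‖² ≤ εν` drift error)
fed with LEMMA X `approximateSolution_of_planarSlaving` (Grenier's approximate solution with the trivial witness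
`U := V_ν`, `ρ := 0`, p794951) and the force bound `DriftFreeClosure.exists_norm_planarForce_le`.  The rate condition
`Λ⋆ = max(max(ρN, 3e^{σ⋆γ}), ρN√2) < r` of LEMMA X follows from the window on the box: `3e^{σ⋆γ} < γ² + 2` on `[4,8]`
(chord bounds of `…ClosureWindow48`) and `ρN ≤ 7`, so `M² < M(γ²+2) < r²`; and `r² > 3e^{4σ⋆}·18 ≥ 3(1+4σ⋆)·18 > (7√2)²`.
No definitions, no named facts.
-/

-- `Summit.<Summit>.<Problem>`: single-conjunct summit, the duplicate namespace segment is deliberate.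
set_option linter.dupNamespace false

noncomputable section

namespace Summit.AnomalousDissipation.AnomalousDissipation.Theorems.SawtoothPulseCascade.K3NonlinearClosureLocalised

open MeasureTheory Set Filter Topology
open Literature.Analysis Literature.Analysis.FunctionSpaces Literature.Analysis.FluidPDE
open Literature.Analysis.FluidPDE.SawtoothCascade
open Literature.Analysis.FluidPDE.SawtoothCascade.DriftFree

/-- On the aside box the Kelvin–Helmholtz cap is below the per-phase envelope: `3 e^{σ⋆γ} < γ² + 2` for `γ ∈ [4,8]`
(chord bounds of `exp` on `[4,5]` and `[5,8]`). -/
theorem three_exp_lt_envelope {γ : ℝ} (hγ : γ ∈ Icc (4 : ℝ) 8) :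
    3 * Real.exp (sawSigmaStar * γ) < γ ^ 2 + 2 := by
  obtain ⟨h4, h8⟩ := hγ
  rcases le_total γ 5 with h5 | h5
  · have hch := exp_sawSigmaStar_mul_le_chord45 h4 h5
    nlinarith
  · have hch := exp_sawSigmaStar_mul_le_chord58 h5 h8
    nlinarith

/-- Inside the closure window on the box, the slaving rate is below the scalar rate:
`max(max(ρN, 3e^{σ⋆γ}), ρN√2) < r`. -/
theorem slavingRate_lt {γ r : ℝ} {ρN : ℕ} (hγ : γ ∈ Icc (4 : ℝ) 8) (hρ7 : ρN ≤ 7) (hr : 1 < r)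
    (hwin : max (ρN : ℝ) (3 * Real.exp (sawSigmaStar * γ)) * (γ ^ 2 + 2) < r ^ 2) :
    max (max (ρN : ℝ) (3 * Real.exp (sawSigmaStar * γ))) ((ρN : ℝ) * Real.sqrt 2) < r := by
  have hr0 : 0 < r := lt_trans one_pos hr
  have hρ7' : (ρN : ℝ) ≤ 7 := by exact_mod_cast hρ7
  set M := max (ρN : ℝ) (3 * Real.exp (sawSigmaStar * γ)) with hM
  have hexp0 : 0 < 3 * Real.exp (sawSigmaStar * γ) := by positivity
  have hM0 : 0 < M := lt_of_lt_of_le hexp0 (le_max_right _ _)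
  have hMenv : M < γ ^ 2 + 2 := by
    refine max_lt ?_ (three_exp_lt_envelope hγ)
    nlinarith [hγ.1]
  -- `M < r`
  have hMr : M < r := by
    have h1 : M * M < r ^ 2 := by
      calc M * M ≤ M * (γ ^ 2 + 2) := mul_le_mul_of_nonneg_left hMenv.le hM0.le
        _ < r ^ 2 := hwin
    nlinarith
  -- `ρN √2 < r`: `r² > 3 e^{4σ⋆}·18 ≥ 3 (1 + 4σ⋆) 18 > 110.25 ≥ (ρN√2)²`
  have hexp4 : 1 + sawSigmaStar * 4 ≤ Real.exp (sawSigmaStar * γ) := by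
    calc 1 + sawSigmaStar * 4 ≤ sawSigmaStar * γ + 1 := by
          have : sawSigmaStar * 4 ≤ sawSigmaStar * γ :=
            mul_le_mul_of_nonneg_left hγ.1 (by norm_num [sawSigmaStar])
          linarith
      _ ≤ Real.exp (sawSigmaStar * γ) := Real.add_one_le_exp _
  have hr2 : (441 / 4 : ℝ) < r ^ 2 := by
    have h18 : (18 : ℝ) ≤ γ ^ 2 + 2 := by nlinarith [hγ.1]
    have h1 : 3 * Real.exp (sawSigmaStar * γ) * (γ ^ 2 + 2) ≤ M * (γ ^ 2 + 2) :=
      mul_le_mul_of_nonneg_right (le_max_right _ _) (by positivity)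
    have h2 : 3 * (1 + sawSigmaStar * 4) * 18 ≤ 3 * Real.exp (sawSigmaStar * γ) * (γ ^ 2 + 2) := by
      have := mul_le_mul (mul_le_mul_of_nonneg_left hexp4 (by norm_num : (0 : ℝ) ≤ 3)) h18 (by norm_num)
        (by positivity)
      linarith
    have h3 : (441 / 4 : ℝ) < 3 * (1 + sawSigmaStar * 4) * 18 := by norm_num [sawSigmaStar]
    linarith
  have hsqrt2 : Real.sqrt 2 < 3 / 2 := by
    rw [Real.sqrt_lt' (by norm_num)]; norm_num
  have hρr : (ρN : ℝ) * Real.sqrt 2 < r := by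
    have h1 : (ρN : ℝ) * Real.sqrt 2 ≤ 7 * (3 / 2) :=
      mul_le_mul hρ7' hsqrt2.le (Real.sqrt_nonneg _) (by norm_num)
    have h2 : (21 / 2 : ℝ) < r := by nlinarith
    linarith
  exact max_lt hMr hρr

/-- **STUB S5 `stub_localisedClosure`** of line `Localised` of the aside `K3NonlinearClosure`
(stmt-AnomalousDissipation-20027, reshape r4): the localised closure at every parameter point of the box — planar
slaving ⇒ Grenier's approximate solution with the trivial witness `U := V_ν` (`approximateSolution_of_planarSlaving`),
then the landed drift-free closure `DriftFreeClosure.planarAnomalousFamily_of` (K1loc's fraction survives the drift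
error `∫₀ᵀ‖V_ν−ū‖² ≤ εν`; dissipation floor of the lift; energy bookkeeping up to `t = 1` by the force bound
`DriftFreeClosure.exists_norm_planarForce_le`). [cite: JohanssonSorella2024, §2 Lemma 2.2 and §10 (proof of Thm. 1.5)]
[cite: Grenier2000, §2–3 (approximate solution + energy estimate on the remainder)] -/
theorem stub_localisedClosure :
    ∀ (P : CascadeParams) (r : ℝ), P.δ₀ = 1 / 4 → P.d = 2 → P.N₀ = 1 → P.γ ∈ Icc (4 : ℝ) 8 → 2 ≤ P.ρN → P.ρN ≤ 7 →
      1 < r → max (P.ρN : ℝ) (3 * Real.exp (sawSigmaStar * P.γ)) * (P.γ ^ 2 + 2) < r ^ 2 →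
      K1Localised P r → Existence P →
      (∀ A : ℕ, ∃ ν₀ : ℝ, 0 < ν₀ ∧ ∃ K : ℝ, ∀ ν ∈ Ioc 0 ν₀,
        ∀ (V : ℝ → UnitAddTorus (Fin 2) → EuclideanSpace ℝ (Fin 2)) (φ : ℝ → UnitAddTorus (Fin 2) → ℝ),
          FunctionSpaces.Torus.IsClassicalNSSolutionOn (Ico (0 : ℝ) 1) ν (planarForce P) V φ → V 0 = 0 →
          ∀ j ≤ Jrate r ν + A, ∀ t ∈ Icc (CascadeParams.tStart j) (CascadeParams.tStart (j + 1)),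
            Real.sqrt (FluidPDE.Torus.vectorL2Sq (V t - P.field t)) ≤
              K * ν * ∑ i ∈ Finset.range (j + 1),
                (P.N i : ℝ) / Real.sqrt (P.δ i) * (max (P.ρN : ℝ) (3 * Real.exp (sawSigmaStar * P.γ))) ^ (j - i)) →
      PlanarAnomalousFamily P := by
  intro P r hδ₀ hd hN₀ hγ hρ hρ7 hr hwin hK1 hEx hPS
  have hδ₀' : 0 < P.δ₀ := by rw [hδ₀]; norm_num
  have hd' : 0 < P.d := by rw [hd]; norm_num
  have hN₀' : 1 ≤ P.N₀ := by rw [hN₀]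
  have hΛr : max (max (P.ρN : ℝ) (3 * Real.exp (sawSigmaStar * P.γ))) ((P.ρN : ℝ) * Real.sqrt P.d) < r := by
    rw [hd]; exact slavingRate_lt hγ hρ7 hr hwin
  have hApp : ApproximateSolution P r :=
    approximateSolution_of_planarSlaving P hδ₀' hd' hN₀' hρ hr hΛr hPS hEx
  obtain ⟨C, hC⟩ := DriftFreeClosure.exists_norm_planarForce_le P hδ₀' hd' hN₀' hρ
  exact DriftFreeClosure.planarAnomalousFamily_of (cascadeFieldSmooth P hδ₀' hd') hK1 hEx hApp hC

end Summit.AnomalousDissipation.AnomalousDissipation.Theorems.SawtoothPulseCascade.K3NonlinearClosureLocalised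

end
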